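import Summits.QuantumFields.BalabanUV.Beta.GAN24.EffectiveFormSecondInsertionLaw
import Summits.QuantumFields.BalabanUV.Beta.GAN24.InsertionChainLawMixed

/-!
# `BalabanUV.Beta.GAN24.EffectiveFormMixedInsertionLaw` — binder row G-an2-4 ∕ (CONV-C), routes R6 × R7 in NE2's operator currency, PART 123: THE LAST PIECE OF `V_{bb′}`.
# The mixed second u-derivative of the effective form along a two-parameter background family, `∂_s∂_tΣ_k|₀ = c⁻¹ċ_sc⁻¹ċ_tc⁻¹ + c⁻¹ċ_tc⁻¹ċ_sc⁻¹ − c⁻¹(c_{st} + c_{ts})c⁻¹`, has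
# its quintic pieces in PART 121 (`effInsMixed_balaban`); this file supplies the `c_k⁻¹c_{k,st}c_k⁻¹` piece on BAŁABAN's (1.18)-averaged tower with two Lipschitz connections, where
# `c_{k,st} = (L^d)^k·QB^{(k)}𝒢P₁𝒢P₂𝒢QB^{(k)ᴴ}` is the unit image of PART 119's ordered mixed chain — UNCONDITIONAL, rate `L^{−k}` (unit b2b-balaban-gan24-p3, gen 51; v1)

NOT IN PRINT; OUR PROOF ([folklore] composition BY NAME: PART 118 `effIns_tendsto_of_geom` ∕ `isUnit_det_unitCovB_and_opNorm_inv_le` ∕ `opNorm_avgTow_le` ∕ `opNorm_avgTow_step_le_of_law`,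
PART 119 `oneStepAveragedLaw_mixedInsertion`, PART 121 `opNorm_mul₃_le`, NE2's `freeTowerLaws_balaban`, `perturbationLaws_firstOrder`, `oneStepAveragedLaw_QB`).
HONEST FRAMING (cell contract, verbatim): «discharging `BetaPertH` makes Bałaban's UV stability UNCONDITIONAL — a real constructive-QFT result; it is NOT the continuum limit and NOT
the Clay problem.»  HONEST DEPENDENCY (verbatim): «continuum YM on T⁴ ⇐ BetaPertH ∧ nine spine estimates (0/9 proved); BetaPertH ⇐ (D1) ∧ (D4) ∧ CAP+tail; G-an2-4 gates asym, D1
and NE2/3/4.»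

WHAT THIS FILE PROVES (0 sorry, 0 `def`, nothing cited): **`mixedInsertionTower_balaban_bounds`** (one-step bound `(3κ²CJ + 2κC2model + κ²(2dCst + 2dLCst))·L^{−k}` and size `κ²Cst` of the mixed
insertion tower, `κ = d(α+β)Cst`) and **`effInsMixedSecond_balaban`** (`c_k⁻¹c_{k,st}c_k⁻¹` converges at rate `L^{−k}`, `c_k = unitCovB k`, UB = `uniformCoercive_unitCovB`) — with PART 121
EVERY piece of the first and second (pure and mixed) u-derivatives `V_b`, `V_{bb′}` of the effective form for the first-order model converges at rate `L^{−k}`, no letter.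
WHAT IT DOES NOT DO: decay; Bałaban's vertices; large couplings.  SUPPLIER work (junction R6 × R7 × NE2); no consumer of record; NEVER «G-an2-4 closed»; NOT (CONV-C), NOT D1,
NOT `BetaPertH`, NOT continuum, NOT Clay.  Records: `HOME/b2b-balaban-gan24-p3/gen51/README.md`.
-/

noncomputable section

open scoped BigOperators ComplexConjugate Matrix Matrix.Norms.L2Operator
open Filter Topology

namespace Summit.QuantumFields.BalabanUV.Beta.GAN24.EffectiveFormMixedInsertionLaw

open Literature.MathematicalPhysics.QuantumFieldTheory.Balaban1983to89.B5Prop11Plancherel (Cst Cst_nonneg)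
open Summit.QuantumFields.BalabanUV.T4Continuum
open Summit.QuantumFields.BalabanUV.T4Continuum.CovariantAveragingTower (avgTow OneStepAveragedLaw)
open Summit.QuantumFields.BalabanUV.T4Continuum.BalabanAveragedTowerUnit (idx QBlev calGlev unitCovB opNorm_QBlev_sq_le oneStepAveragedLaw_QB)
open Summit.QuantumFields.BalabanUV.T4Continuum.BalabanLineAverage (CQB)
open Summit.QuantumFields.BalabanUV.T4Continuum.KingPairingPlantedLaw (JpcT calDalev calDalev_inv CJ opNorm_inv_calDalev_le)
open Summit.QuantumFields.BalabanUV.T4Continuum.FirstOrderBackgroundModel (LipschitzBackground Pmodel C2model perturbationLaws_firstOrder)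
open Summit.QuantumFields.BalabanUV.T4Continuum.BalabanAveragingPairing (freeTowerLaws_balaban)
open Summit.QuantumFields.BalabanUV.T4Continuum.BalabanAveragedCoercive (gammaB gammaB_pos)
open Summit.QuantumFields.BalabanUV.Beta.GAN24.InsertionChainLawMixed (oneStepAveragedLaw_mixedInsertion)
open Summit.QuantumFields.BalabanUV.Beta.GAN24.EffectiveFormInsertionLaw (effIns_tendsto_of_geom opNorm_avgTow_le opNorm_avgTow_step_le_of_law
  isUnit_det_unitCovB_and_opNorm_inv_le)
open Summit.QuantumFields.BalabanUV.Beta.GAN24.EffectiveFormSecondInsertionLaw (opNorm_mul₃_le)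

variable {d : ℕ} (L : ℕ) [NeZero L] (M : Fin d → ℕ) [hM : ∀ μ, NeZero (M μ)] (a : ℝ) (ha : 0 < a)

/-- the MIXED insertion tower `c_{k,st} = (L^d)^k·QB^{(k)}𝒢P₁𝒢P₂𝒢QB^{(k)ᴴ}` on Bałaban's averaged tower (two Lipschitz connections, common `(α, β)`): one-step bound (PART 119
`oneStepAveragedLaw_mixedInsertion` over `freeTowerLaws_balaban`) `(3κ²CJ + 2κ·C2model + κ²(2dCst + 2dLCst))·L^{−k}` and size `≤ κ²Cst`. [our proof] -/
theorem mixedInsertionTower_balaban_bounds (hd : 1 ≤ d) {V₁ V₂ : (k : ℕ) → Fin d → (idx L M k → ℂ)} {α β : ℝ} (hV₁ : LipschitzBackground L M V₁ α β)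
    (hV₂ : LipschitzBackground L M V₂ α β) :
    (∀ k, ‖avgTow (QBlev L M) ((L : ℝ) ^ d) (fun k => calGlev L M a ha k * Pmodel L M V₁ k * calGlev L M a ha k * Pmodel L M V₂ k * calGlev L M a ha k) (k + 1)
        - avgTow (QBlev L M) ((L : ℝ) ^ d) (fun k => calGlev L M a ha k * Pmodel L M V₁ k * calGlev L M a ha k * Pmodel L M V₂ k * calGlev L M a ha k) k‖
        ≤ ((3 * (d * (α + β) * Cst d a) ^ 2 * CJ d a + 2 * (d * (α + β) * Cst d a) * C2model d L a α β)
            + (d * (α + β) * Cst d a) ^ 2 * (2 * d * Cst d a + 2 * (d * L * Cst d a))) * ((L : ℝ)⁻¹) ^ k) ∧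
    (∀ k, ‖avgTow (QBlev L M) ((L : ℝ) ^ d) (fun k => calGlev L M a ha k * Pmodel L M V₁ k * calGlev L M a ha k * Pmodel L M V₂ k * calGlev L M a ha k) k‖
        ≤ (d * (α + β) * Cst d a) ^ 2 * Cst d a) := by
  have hr : (0 : ℝ) < (L : ℝ) ^ d := pow_pos (by exact_mod_cast Nat.pos_of_ne_zero (NeZero.ne L)) d
  have hP₁ := perturbationLaws_firstOrder L M a ha hd hV₁
  have hP₂ := perturbationLaws_firstOrder L M a ha hd hV₂
  have e : (fun k => (calDalev L M a ha k)⁻¹ * Pmodel L M V₁ k * (calDalev L M a ha k)⁻¹ * Pmodel L M V₂ k * (calDalev L M a ha k)⁻¹)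
      = fun k => calGlev L M a ha k * Pmodel L M V₁ k * calGlev L M a ha k * Pmodel L M V₂ k * calGlev L M a ha k := by
    funext k
    rw [calDalev_inv]
  have hlaw := oneStepAveragedLaw_mixedInsertion hr (freeTowerLaws_balaban L M a ha) hP₁ hP₂
  rw [e] at hlaw
  refine ⟨fun k => ?_, fun k => ?_⟩
  · refine (opNorm_avgTow_step_le_of_law hr (opNorm_QBlev_sq_le L M) hlaw k).trans (le_of_eq ?_)
    ring
  · refine (opNorm_avgTow_le hr (opNorm_QBlev_sq_le L M) _ k).trans ?_
    have h1 : ‖calGlev L M a ha k * Pmodel L M V₁ k‖ ≤ d * (α + β) * Cst d a := by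
      rw [← calDalev_inv]; exact hP₁.opNorm_inv_mul_P_le k
    have h2 : ‖calGlev L M a ha k * Pmodel L M V₂ k‖ ≤ d * (α + β) * Cst d a := by
      rw [← calDalev_inv]; exact hP₂.opNorm_inv_mul_P_le k
    have h3 : ‖calGlev L M a ha k‖ ≤ Cst d a := by rw [← calDalev_inv]; exact opNorm_inv_calDalev_le L M a ha k
    have e3 : calGlev L M a ha k * Pmodel L M V₁ k * calGlev L M a ha k * Pmodel L M V₂ k * calGlev L M a ha k
        = (calGlev L M a ha k * Pmodel L M V₁ k) * (calGlev L M a ha k * Pmodel L M V₂ k) * calGlev L M a ha k := by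
      simp only [Matrix.mul_assoc]
    rw [e3]
    calc _ ≤ (d * (α + β) * Cst d a) * (d * (α + β) * Cst d a) * Cst d a := opNorm_mul₃_le h1 h2 h3
      _ = (d * (α + β) * Cst d a) ^ 2 * Cst d a := by ring

/-- **`effInsMixedSecond_balaban` — THE PIECE `c_k⁻¹c_{k,st}c_k⁻¹` OF THE MIXED SECOND u-DERIVATIVE `V_{bb′}` CONVERGES AT RATE `L^{−k}`, UNCONDITIONALLY** [our proof] (PART 118's
`effIns_tendsto_of_geom` with the mixed insertion tower of PART 119 on Bałaban's averaged tower).  With `effInsMixed_balaban` this completes the mixed second derivative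
`∂_s∂_tΣ_k|₀ = c⁻¹ċ_sc⁻¹ċ_tc⁻¹ + c⁻¹ċ_tc⁻¹ċ_sc⁻¹ − c⁻¹(c_{st} + c_{ts})c⁻¹` of the effective form for the first-order model: every piece converges at rate `L^{−k}`. -/
theorem effInsMixedSecond_balaban (hL : 2 ≤ L) (hd : 1 ≤ d) {V₁ V₂ : (k : ℕ) → Fin d → (idx L M k → ℂ)} {α β : ℝ} (hV₁ : LipschitzBackground L M V₁ α β)
    (hV₂ : LipschitzBackground L M V₂ α β) :
    ∃ Ilim : Matrix (idx L M 0) (idx L M 0) ℂ,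
      Tendsto (fun k => (unitCovB L M a ha k)⁻¹
          * avgTow (QBlev L M) ((L : ℝ) ^ d) (fun k => calGlev L M a ha k * Pmodel L M V₁ k * calGlev L M a ha k * Pmodel L M V₂ k * calGlev L M a ha k) k
          * (unitCovB L M a ha k)⁻¹) atTop (𝓝 Ilim) ∧
      ∀ k, ‖(unitCovB L M a ha k)⁻¹
          * avgTow (QBlev L M) ((L : ℝ) ^ d) (fun k => calGlev L M a ha k * Pmodel L M V₁ k * calGlev L M a ha k * Pmodel L M V₂ k * calGlev L M a ha k) k
          * (unitCovB L M a ha k)⁻¹ - Ilim‖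
        ≤ (((gammaB d a)⁻¹) ^ 2 * ((3 * (d * (α + β) * Cst d a) ^ 2 * CJ d a + 2 * (d * (α + β) * Cst d a) * C2model d L a α β)
              + (d * (α + β) * Cst d a) ^ 2 * (2 * d * Cst d a + 2 * (d * L * Cst d a)))
            + 2 * ((gammaB d a)⁻¹) ^ 3 * ((d * (α + β) * Cst d a) ^ 2 * Cst d a) * CQB d a) * ((L : ℝ)⁻¹) ^ k / (1 - (L : ℝ)⁻¹) := by
  have hL1 : (1 : ℝ) < L := by exact_mod_cast (lt_of_lt_of_le one_lt_two hL : 1 < L)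
  have hr : (0 : ℝ) < (L : ℝ) ^ d := pow_pos (lt_trans zero_lt_one hL1) d
  obtain ⟨hXX, hXm⟩ := mixedInsertionTower_balaban_bounds L M a ha hd hV₁ hV₂
  have hcc : ∀ k, ‖unitCovB L M a ha (k + 1) - unitCovB L M a ha k‖ ≤ CQB d a * ((L : ℝ)⁻¹) ^ k := fun k =>
    opNorm_avgTow_step_le_of_law hr (opNorm_QBlev_sq_le L M) (oneStepAveragedLaw_QB L M a ha) k
  exact effIns_tendsto_of_geom (cc := unitCovB L M a ha) (fun k => (isUnit_det_unitCovB_and_opNorm_inv_le L M a ha k).1)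
    (fun k => (isUnit_det_unitCovB_and_opNorm_inv_le L M a ha k).2) hXm (inv_lt_one_of_one_lt₀ hL1) hcc hXX

end Summit.QuantumFields.BalabanUV.Beta.GAN24.EffectiveFormMixedInsertionLaw

end
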